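import Literature.AlgebraicGeometry.Motives.HodgeLieIdealOfThetaSubalgebra
import Literature.AlgebraicGeometry.Motives.HodgeLieReductiveAnyWeight
import HarnessLib

/-!
# `Θ`-rigidity holds modulo the centre: every `Θ`-subalgebra `𝔞 ⊆ 𝔥(H)` of a polarizable Hodge structure contains `[𝔥, 𝔥]`,
# `𝔥 = 𝔞 + 𝔷(𝔥)`, and `H` is `Θ`-rigid as soon as `𝔷(𝔥) = 𝔥 ∩ End_Hdg = 0` (Deligne I Prop. 3.6 + GGK (I.B.5); Moonen–Zarhin (3.1))

Family `hodge`, layer `Literature/AlgebraicGeometry/Motives`.  THEOREMS ONLY (no definition, no named fact).  Written for the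
cell `pub-hodgecm2` (COR-CM), seat `b27` gen 54 (count-neutral Mumford–Tate-rank ladder, «rigidity modulo the centre», part 3).

`H` a POLARIZED pure `ℚ`-Hodge structure of any weight `n` on a finite-dimensional `V`; `𝔥 = Lie Hg(H)` (`hodgeLie`),
`𝔷 = 𝔥 ∩ End_Hdg(V)` its centre and `𝔡 = [𝔥, 𝔥]` its (semisimple) derived algebra, `𝔥 = 𝔷 ⊕ 𝔡` (`HodgeLieReductiveAnyWeight`,
Deligne I Prop. 3.6 in Lie form).  A «`Θ`-subalgebra» is a bracket-closed rational `𝔞 ⊆ 𝔥` whose complex span contains a Hodge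
operator (`2p − n` on `V^{p,n−p}`); `H` is «`Θ`-RIGID» when every `Θ`-subalgebra is all of `𝔥` (the hypothesis of the ladder's
monotonicity `dim 𝔥(H ⊕ H') ≥ dim 𝔥(H)`, `Motives/HodgeLieProductSimpleFactor`; Moonen–Zarhin (3.1)).
* **`derived_le_of_theta_mem`** — EVERY `Θ`-subalgebra contains `𝔡 = [𝔥, 𝔥]`.  PROOF: `𝔞` is an ideal of `𝔥` (part 2,
  `commutator_mem_of_theta_mem`); `I = 𝔞 ∩ 𝔡` is an ideal of the semisimple `𝔡`, with complementary ideal `J`, `[I, J] = 0`; for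
  `a ∈ J`, `A = z + d_I + d_J ∈ 𝔞`: `[a, A] = [a, d_J] ∈ 𝔞 ∩ 𝔡 ∩ J = I ∩ J = 0`, so `J` commutes with `𝔞`, hence with `Θ ∈ 𝔞 ⊗ ℂ`,
  so `J ⊆ End_Hdg ∩ 𝔥 ∩ 𝔡 = 𝔷 ∩ 𝔡 = 0` and `I = 𝔡`.
* **`hodgeLie_le_sup_center_of_theta_mem`** — `𝔥 = 𝔞 + 𝔷`; **`hodgeLie_le_of_theta_mem_of_center_le`** — `𝔷 ⊆ 𝔞 ⟹ 𝔞 = 𝔥`;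
  **`rigid_of_center_eq_bot`** — `𝔷 = 0 ⟹ H is Θ-rigid` (in the exact shape of the ladder's rigidity hypotheses).
* `mem_endAlg_of_commute_theta` — a rational endomorphism whose complexification commutes with a Hodge operator is a Hodge endomorphism.

## References
* [Deligne1982HodgeCycles] P. Deligne, LNM 900 (1982), I §3 Prop. 3.4, Prop. 3.6. [cite: Deligne1982HodgeCycles, I §3 Prop. 3.6]
* [MoonenZarhin1999LowDim] B. Moonen, Yu. G. Zarhin, Math. Ann. 315 (1999), §3 (3.1) [corpus: paper:arxiv-math_9901113 p. 6].
  [cite: MoonenZarhin1999LowDim, §3 (3.1)]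
* [GreenGriffithsKerr2012] M. Green, P. Griffiths, M. Kerr, *Mumford–Tate Groups and Domains* (2012), §I.B (I.B.5).
  [cite: GreenGriffithsKerr2012, §I.B (I.B.3) and (I.B.5)]
* [Humphreys1972] J. E. Humphreys, GTM 9 (1972), §5.2 (ideals of a semisimple Lie algebra). [cite: Humphreys1972, §5.2]
-/

noncomputable section

open scoped TensorProduct

namespace Literature.AlgebraicGeometry.Motives

namespace HodgeStructure

universe u

variable {V : Type u} [AddCommGroup V] [Module ℚ V] [Module.Finite ℚ V] [HodgeTensorFacts.{u, u}] {n : ℤ}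

/-! ### §1 Commuting with a Hodge operator -/

omit [Module.Finite ℚ V] [HodgeTensorFacts.{u, u}] in
/-- An eigenvector of a Hodge operator for the eigenvalue `2p − n` lies in `V^{p,n−p}`. [cite: Deligne1982HodgeCycles, I §3 Prop. 3.6] -/
theorem mem_piece_of_theta_apply_eq_smul (H : HodgeStructure V n) {Θ : Module.End ℂ (ℂ ⊗[ℚ] V)}
    (hΘ : ∀ p, ∀ x ∈ H.piece p (n - p), Θ x = ((2 * p - n : ℤ) : ℂ) • x) {p : ℤ} {y : ℂ ⊗[ℚ] V}
    (hy : Θ y = ((2 * p - n : ℤ) : ℂ) • y) : y ∈ H.piece p (n - p) := by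
  classical
  refine mem_piece_of_forall_ne_pieceProj_eq_zero H fun q hqp => ?_
  -- `π_q (Θ y) = (2q - n) π_q y` and `= (2p - n) π_q y`
  have hΘy : Θ y = ∑ r ∈ H.pieceSupport y, ((2 * r - n : ℤ) : ℂ) • H.pieceProj r y := by
    conv_lhs => rw [← sum_pieceProj H y]
    rw [map_sum]
    exact Finset.sum_congr rfl fun r _ => hΘ r _ (pieceProj_mem H r y)
  have hproj : ∀ r, H.pieceProj q (H.pieceProj r y) = if r = q then H.pieceProj q y else 0 := by
    intro r
    by_cases hrq : r = q
    · subst hrq; rw [if_pos rfl, pieceProj_apply_of_mem H (pieceProj_mem H r y)]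
    · rw [if_neg hrq, pieceProj_apply_of_mem_ne H hrq (pieceProj_mem H r y)]
  have h1 : H.pieceProj q (Θ y) = ((2 * q - n : ℤ) : ℂ) • H.pieceProj q y := by
    rw [hΘy, map_sum]
    simp_rw [map_smul, hproj, smul_ite, smul_zero]
    rw [Finset.sum_ite_eq' (H.pieceSupport y) q]
    split_ifs with hq
    · rfl
    · rw [pieceProj_eq_zero_of_not_mem_pieceSupport H hq, smul_zero]
  have h2 : H.pieceProj q (Θ y) = ((2 * p - n : ℤ) : ℂ) • H.pieceProj q y := by rw [hy, map_smul]
  have h3 : (((2 * q - n : ℤ) : ℂ) - ((2 * p - n : ℤ) : ℂ)) • H.pieceProj q y = 0 := by rw [sub_smul, ← h1, ← h2, sub_self]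
  rcases smul_eq_zero.1 h3 with h | h
  · exfalso
    have h' : ((2 * q - n : ℤ) : ℂ) = ((2 * p - n : ℤ) : ℂ) := sub_eq_zero.1 h
    have h'' : (2 * q - n : ℤ) = 2 * p - n := by exact_mod_cast h'
    exact hqp (by omega)
  · exact h

omit [Module.Finite ℚ V] [HodgeTensorFacts.{u, u}] in
/-- **A rational endomorphism whose complexification commutes with a Hodge operator is a Hodge endomorphism** (the Hodge pieces are
the eigenspaces of `Θ`). [cite: Deligne1982HodgeCycles, I §3 Prop. 3.6] -/
theorem mem_endAlg_of_commute_theta (H : HodgeStructure V n) {Θ : Module.End ℂ (ℂ ⊗[ℚ] V)}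
    (hΘ : ∀ p, ∀ x ∈ H.piece p (n - p), Θ x = ((2 * p - n : ℤ) : ℂ) • x) {c : Module.End ℚ V}
    (hc : c.baseChange ℂ * Θ = Θ * c.baseChange ℂ) : c ∈ H.endAlg := by
  have hpres : ∀ p, ∀ x ∈ H.piece p (n - p), c.baseChange ℂ x ∈ H.piece p (n - p) := by
    intro p x hx
    refine mem_piece_of_theta_apply_eq_smul H hΘ ?_
    rw [← Module.End.mul_apply, ← hc, Module.End.mul_apply, hΘ p x hx, map_smul]
  rw [mem_endAlg_iff]
  intro p
  rw [Submodule.map_le_iff_le_comap, F_eq_iSup_piece_holds H p]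
  refine iSup₂_le fun i hi x hx => ?_
  exact Submodule.mem_iSup_of_mem i (Submodule.mem_iSup_of_mem hi (hpres i x hx))

omit [Module.Finite ℚ V] [HodgeTensorFacts.{u, u}] in
/-- A rational endomorphism commuting with a rational subspace `𝔞` whose complex span contains a Hodge operator is a Hodge endomorphism.
[cite: Deligne1982HodgeCycles, I §3 Prop. 3.6] -/
theorem mem_endAlg_of_forall_commute_of_theta_mem (H : HodgeStructure V n) (𝔞 : Submodule ℚ (Module.End ℚ V))
    (hΘ : ∃ Θ ∈ Submodule.span ℂ ((fun X : Module.End ℚ V => X.baseChange ℂ) '' (𝔞 : Set (Module.End ℚ V))),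
      ∀ p, ∀ x ∈ H.piece p (n - p), Θ x = ((2 * p - n : ℤ) : ℂ) • x)
    {c : Module.End ℚ V} (hc : ∀ A ∈ 𝔞, c * A = A * c) : c ∈ H.endAlg := by
  obtain ⟨Θ, hΘmem, hΘ⟩ := hΘ
  have hcomm : ∀ Y ∈ Submodule.span ℂ ((fun X : Module.End ℚ V => X.baseChange ℂ) '' (𝔞 : Set (Module.End ℚ V))),
      c.baseChange ℂ * Y = Y * c.baseChange ℂ := by
    intro Y hY
    induction hY using Submodule.span_induction with
    | mem Z hZ =>
      obtain ⟨A, hA, rfl⟩ := hZ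
      have h := congrArg (LinearMap.baseChange ℂ) (hc A hA)
      rw [LinearMap.baseChange_mul, LinearMap.baseChange_mul] at h
      exact h
    | zero => simp
    | add Z Z' _ _ hZ hZ' => rw [mul_add, add_mul, hZ, hZ']
    | smul a Z _ hZ => rw [mul_smul_comm, smul_mul_assoc, hZ]
  exact mem_endAlg_of_commute_theta H hΘ (hcomm Θ hΘmem)

/-! ### §2 Every `Θ`-subalgebra of `𝔥(H)` contains the derived algebra -/

set_option maxHeartbeats 800000 in
/-- **Every `Θ`-subalgebra `𝔞 ⊆ 𝔥(H)` contains `[𝔥, 𝔥]`** (`H` polarized, any weight): `𝔞` is an ideal of `𝔥`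
(`commutator_mem_of_theta_mem`), `𝔞 ∩ 𝔡` is an ideal of the semisimple `𝔡 = [𝔥, 𝔥]` whose complementary ideal `J` commutes with `𝔞`,
hence with `Θ`, hence lies in `End_Hdg ∩ 𝔡 ⊆ 𝔷 ∩ 𝔡 = 0`. [cite: Deligne1982HodgeCycles, I §3 Prop. 3.6] [cite: MoonenZarhin1999LowDim, §3 (3.1)]
[cite: Humphreys1972, §5.2] -/
theorem derived_le_of_theta_mem (H : HodgeStructure V n) (ψ : H.Polarization) (𝔞 : Submodule ℚ (Module.End ℚ V))
    (h𝔞 : 𝔞 ≤ H.hodgeLie) (hbr : ∀ X ∈ 𝔞, ∀ Y ∈ 𝔞, X * Y - Y * X ∈ 𝔞)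
    (hΘ : ∃ Θ ∈ Submodule.span ℂ ((fun X : Module.End ℚ V => X.baseChange ℂ) '' (𝔞 : Set (Module.End ℚ V))),
      ∀ p, ∀ x ∈ H.piece p (n - p), Θ x = ((2 * p - n : ℤ) : ℂ) • x) :
    Submodule.span ℚ {B | ∃ X ∈ H.hodgeLie, ∃ Y ∈ H.hodgeLie, X * Y - Y * X = B} ≤ 𝔞 := by
  classical
  letI : LieRing (Module.End ℚ V) := LieRing.ofAssociativeRing
  set 𝔡 := Submodule.span ℚ {B | ∃ X ∈ H.hodgeLie, ∃ Y ∈ H.hodgeLie, X * Y - Y * X = B} with h𝔡def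
  have hideal : ∀ X ∈ H.hodgeLie, ∀ A ∈ 𝔞, X * A - A * X ∈ 𝔞 := fun X hX A hA =>
    commutator_mem_of_theta_mem H ⟨ψ⟩ 𝔞 hbr hΘ hX hA
  have h𝔡le : 𝔡 ≤ H.hodgeLie :=
    Literature.Algebra.Lie.TraceSeparating.derived_le H.hodgeLie fun X hX Y hY => H.commutator_mem_hodgeLie hX hY
  obtain ⟨𝔏, h𝔏⟩ := exists_lieSubalgebra_eq_hodgeLie_derived H
  have hmem𝔏 : ∀ {x : Module.End ℚ V}, x ∈ 𝔏 ↔ x ∈ 𝔡 := fun {x} => by rw [← LieSubalgebra.mem_toSubmodule, h𝔏]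
  haveI : LieAlgebra.IsSemisimple ℚ 𝔏 := AnyWeight.isSemisimple_of_eq_hodgeLie_derived H ψ 𝔏 h𝔏
  -- `I = 𝔞 ∩ 𝔡` as an ideal of `𝔏`, and its complement `J`
  let I : LieIdeal ℚ 𝔏 :=
    { (𝔞.comap 𝔏.toSubmodule.subtype) with
      lie_mem := fun {x m} hm => by
        change ((⁅x, m⁆ : 𝔏) : Module.End ℚ V) ∈ 𝔞
        rw [LieSubalgebra.coe_bracket, Ring.lie_def]
        exact hideal _ (h𝔡le (hmem𝔏.1 x.2)) _ hm }
  have hI : ∀ {x : 𝔏}, x ∈ I ↔ (x : Module.End ℚ V) ∈ 𝔞 := fun {x} => Iff.rfl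
  set J : LieIdeal ℚ 𝔏 := Iᶜ with hJ
  have hIJ : I ⊓ J = ⊥ := inf_compl_eq_bot
  have hIJ' : I ⊔ J = ⊤ := sup_compl_eq_top
  have hbr0 : ∀ x ∈ I, ∀ y ∈ J, (x : Module.End ℚ V) * y - y * x = 0 := by
    intro x hx y hy
    have h1 : ⁅x, y⁆ ∈ I := by rw [← lie_skew]; exact I.neg_mem (I.lie_mem hx)
    have h2 : ⁅x, y⁆ ∈ J := J.lie_mem hy
    have h12 : ⁅x, y⁆ ∈ I ⊓ J := (LieSubmodule.mem_inf _ _ _).2 ⟨h1, h2⟩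
    rw [hIJ, LieSubmodule.mem_bot] at h12
    have h := congrArg (fun z : 𝔏 => (z : Module.End ℚ V)) h12
    simpa only [LieSubalgebra.coe_bracket, Ring.lie_def, ZeroMemClass.coe_zero] using h
  -- `J` commutes with `𝔞`
  have hJcomm : ∀ a ∈ J, ∀ A ∈ 𝔞, (a : Module.End ℚ V) * A = A * a := by
    intro a ha A hA
    have hA𝔥 : A ∈ H.hodgeLie ⊓ Subalgebra.toSubmodule H.endAlg ⊔ 𝔡 := by
      rw [AnyWeight.hodgeLie_center_sup_derived_eq H ψ]; exact h𝔞 hA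
    obtain ⟨z, hz, d, hd, rfl⟩ := Submodule.mem_sup.1 hA𝔥
    have ha𝔥 : (a : Module.End ℚ V) ∈ H.hodgeLie := h𝔡le (hmem𝔏.1 a.2)
    have hza : (a : Module.End ℚ V) * z = z * a := H.commute_of_mem_hodgeLie ha𝔥 ⟨z, (Submodule.mem_inf.1 hz).2⟩
    -- split `d = d_I + d_J`
    have hd' : (⟨d, hmem𝔏.2 hd⟩ : 𝔏) ∈ I ⊔ J := by rw [hIJ']; exact LieSubmodule.mem_top _
    obtain ⟨dI, hdI, dJ, hdJ, hdd⟩ := (LieSubmodule.mem_sup _ _ _).1 hd'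
    have hdd' : d = (dI : Module.End ℚ V) + dJ := by
      have h := congrArg (fun w : 𝔏 => (w : Module.End ℚ V)) hdd
      simpa only [AddMemClass.coe_add] using h.symm
    -- `[a, A] = [a, d_J]` lies in `𝔞 ∩ J`, an element of `I ⊓ J = 0`
    have hc1 : (a : Module.End ℚ V) * (z + d) - (z + d) * a = a * dJ - dJ * a := by
      rw [hdd', mul_add, mul_add, add_mul, add_mul, hza]
      have h0 := hbr0 dI hdI a ha
      have h0' : (a : Module.End ℚ V) * dI = dI * a := by rw [← sub_eq_zero, ← neg_sub, neg_eq_zero]; exact h0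
      rw [h0']
      abel
    have hmem𝔞 : (a : Module.End ℚ V) * (z + d) - (z + d) * a ∈ 𝔞 := hideal _ ha𝔥 _ hA
    rw [hc1] at hmem𝔞
    have hJmem : ⁅a, dJ⁆ ∈ J := by rw [← lie_skew]; exact J.neg_mem (J.lie_mem ha)
    have hImem : ⁅a, dJ⁆ ∈ I := by
      rw [hI, LieSubalgebra.coe_bracket, Ring.lie_def]; exact hmem𝔞
    have h0 : ⁅a, dJ⁆ ∈ I ⊓ J := (LieSubmodule.mem_inf _ _ _).2 ⟨hImem, hJmem⟩
    rw [hIJ, LieSubmodule.mem_bot] at h0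
    have h0' := congrArg (fun w : 𝔏 => (w : Module.End ℚ V)) h0
    simp only [LieSubalgebra.coe_bracket, Ring.lie_def, ZeroMemClass.coe_zero] at h0'
    rw [← sub_eq_zero, hc1]
    exact h0'
  -- hence `J ⊆ End_Hdg ∩ 𝔥 ∩ 𝔡 = 0`
  have hJ0 : J = ⊥ := by
    rw [eq_bot_iff]
    intro a ha
    have hE : (a : Module.End ℚ V) ∈ H.endAlg := mem_endAlg_of_forall_commute_of_theta_mem H 𝔞 hΘ (hJcomm a ha)
    have ha𝔡 : (a : Module.End ℚ V) ∈ 𝔡 := hmem𝔏.1 a.2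
    have h := Submodule.mem_inf.2 ⟨Submodule.mem_inf.2 ⟨h𝔡le ha𝔡, (Subalgebra.mem_toSubmodule _).2 hE⟩, ha𝔡⟩
    rw [hodgeLie_center_inf_derived_eq_bot H ψ, Submodule.mem_bot] at h
    rw [LieSubmodule.mem_bot]
    exact Subtype.ext h
  have hItop : I = ⊤ := by rw [← hIJ', hJ0, sup_bot_eq]
  intro d hd
  have h : (⟨d, hmem𝔏.2 hd⟩ : 𝔏) ∈ I := by rw [hItop]; exact LieSubmodule.mem_top _
  exact h

/-! ### §3 `𝔥 = 𝔞 + 𝔷`; `Θ`-rigidity from `𝔷 = 0` -/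

/-- **`𝔥 ⊆ 𝔞 + 𝔷` for every `Θ`-subalgebra `𝔞 ⊆ 𝔥`** (`𝔥 = 𝔷 ⊕ 𝔡` and `𝔡 ⊆ 𝔞`). [cite: Deligne1982HodgeCycles, I §3 Prop. 3.6]
[cite: MoonenZarhin1999LowDim, §3 (3.1)] -/
theorem hodgeLie_le_sup_center_of_theta_mem (H : HodgeStructure V n) (ψ : H.Polarization) (𝔞 : Submodule ℚ (Module.End ℚ V))
    (h𝔞 : 𝔞 ≤ H.hodgeLie) (hbr : ∀ X ∈ 𝔞, ∀ Y ∈ 𝔞, X * Y - Y * X ∈ 𝔞)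
    (hΘ : ∃ Θ ∈ Submodule.span ℂ ((fun X : Module.End ℚ V => X.baseChange ℂ) '' (𝔞 : Set (Module.End ℚ V))),
      ∀ p, ∀ x ∈ H.piece p (n - p), Θ x = ((2 * p - n : ℤ) : ℂ) • x) :
    H.hodgeLie ≤ 𝔞 ⊔ H.hodgeLie ⊓ Subalgebra.toSubmodule H.endAlg := by
  have h𝔡 := derived_le_of_theta_mem H ψ 𝔞 h𝔞 hbr hΘ
  intro X hX
  rw [← AnyWeight.hodgeLie_center_sup_derived_eq H ψ] at hX
  obtain ⟨z, hz, d, hd, rfl⟩ := Submodule.mem_sup.1 hX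
  exact Submodule.add_mem _ (Submodule.mem_sup_right hz) (Submodule.mem_sup_left (h𝔡 hd))

/-- **A `Θ`-subalgebra containing the centre is everything**: `𝔷 ⊆ 𝔞 ⟹ 𝔥 ⊆ 𝔞`. [cite: Deligne1982HodgeCycles, I §3 Prop. 3.6]
[cite: MoonenZarhin1999LowDim, §3 (3.1)] -/
theorem hodgeLie_le_of_theta_mem_of_center_le (H : HodgeStructure V n) (ψ : H.Polarization) (𝔞 : Submodule ℚ (Module.End ℚ V))
    (h𝔞 : 𝔞 ≤ H.hodgeLie) (hbr : ∀ X ∈ 𝔞, ∀ Y ∈ 𝔞, X * Y - Y * X ∈ 𝔞)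
    (hΘ : ∃ Θ ∈ Submodule.span ℂ ((fun X : Module.End ℚ V => X.baseChange ℂ) '' (𝔞 : Set (Module.End ℚ V))),
      ∀ p, ∀ x ∈ H.piece p (n - p), Θ x = ((2 * p - n : ℤ) : ℂ) • x)
    (h𝔷 : H.hodgeLie ⊓ Subalgebra.toSubmodule H.endAlg ≤ 𝔞) : H.hodgeLie ≤ 𝔞 :=
  (hodgeLie_le_sup_center_of_theta_mem H ψ 𝔞 h𝔞 hbr hΘ).trans (sup_le le_rfl h𝔷)

/-- **`𝔷(𝔥) = 0 ⟹ H is Θ-rigid`**: a polarizable Hodge structure whose Hodge Lie algebra meets `End_Hdg` trivially (e.g. `H¹` of an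
abelian variety without factors of type IV) is `Θ`-RIGID — every bracket-closed rational `𝔞 ⊆ 𝔥(H)` whose complex span contains a
Hodge operator is `𝔥(H)` (the hypothesis of `Motives/HodgeLieProductSimpleFactor`, `CorCM/MumfordTateRankRigidMonotone`).
[cite: MoonenZarhin1999LowDim, §3 (3.1)] [cite: Deligne1982HodgeCycles, I §3 Prop. 3.6] -/
theorem rigid_of_center_eq_bot (H : HodgeStructure V n) (hH : H.IsPolarizable)
    (h𝔷 : H.hodgeLie ⊓ Subalgebra.toSubmodule H.endAlg = ⊥) :
    ∀ 𝔞 : Submodule ℚ (Module.End ℚ V), 𝔞 ≤ H.hodgeLie →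
      (∀ X ∈ 𝔞, ∀ Y ∈ 𝔞, X * Y - Y * X ∈ 𝔞) →
      (∃ Θ ∈ Submodule.span ℂ ((fun X : Module.End ℚ V => X.baseChange ℂ) '' (𝔞 : Set (Module.End ℚ V))),
        ∀ p, ∀ x ∈ H.piece p (n - p), Θ x = ((2 * p - n : ℤ) : ℂ) • x) → H.hodgeLie ≤ 𝔞 := by
  obtain ⟨ψ⟩ := hH
  intro 𝔞 h𝔞 hbr hΘ
  exact hodgeLie_le_of_theta_mem_of_center_le H ψ 𝔞 h𝔞 hbr hΘ (by rw [h𝔷]; exact bot_le)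

/-- **`Θ`-rigidity is decided on the centre**: `H` is `Θ`-rigid iff every `Θ`-subalgebra of `𝔥(H)` contains `𝔷(𝔥) = 𝔥 ∩ End_Hdg`.
[cite: MoonenZarhin1999LowDim, §3 (3.1)] [cite: Deligne1982HodgeCycles, I §3 Prop. 3.6] -/
theorem rigid_iff_forall_center_le (H : HodgeStructure V n) (hH : H.IsPolarizable) :
    (∀ 𝔞 : Submodule ℚ (Module.End ℚ V), 𝔞 ≤ H.hodgeLie →
      (∀ X ∈ 𝔞, ∀ Y ∈ 𝔞, X * Y - Y * X ∈ 𝔞) →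
      (∃ Θ ∈ Submodule.span ℂ ((fun X : Module.End ℚ V => X.baseChange ℂ) '' (𝔞 : Set (Module.End ℚ V))),
        ∀ p, ∀ x ∈ H.piece p (n - p), Θ x = ((2 * p - n : ℤ) : ℂ) • x) → H.hodgeLie ≤ 𝔞) ↔
    (∀ 𝔞 : Submodule ℚ (Module.End ℚ V), 𝔞 ≤ H.hodgeLie →
      (∀ X ∈ 𝔞, ∀ Y ∈ 𝔞, X * Y - Y * X ∈ 𝔞) →
      (∃ Θ ∈ Submodule.span ℂ ((fun X : Module.End ℚ V => X.baseChange ℂ) '' (𝔞 : Set (Module.End ℚ V))),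
        ∀ p, ∀ x ∈ H.piece p (n - p), Θ x = ((2 * p - n : ℤ) : ℂ) • x) → H.hodgeLie ⊓ Subalgebra.toSubmodule H.endAlg ≤ 𝔞) := by
  obtain ⟨ψ⟩ := hH
  refine ⟨fun h 𝔞 h𝔞 hbr hΘ => inf_le_left.trans (h 𝔞 h𝔞 hbr hΘ), fun h 𝔞 h𝔞 hbr hΘ => ?_⟩
  exact hodgeLie_le_of_theta_mem_of_center_le H ψ 𝔞 h𝔞 hbr hΘ (h 𝔞 h𝔞 hbr hΘ)

end HodgeStructure

end Literature.AlgebraicGeometry.Motives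

end
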